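import Summits.NavierStokesRegularity.NavierStokesRegularity.Theorems.StretchingWellBindingEnstrophyQuarterLawStubSmoothingEnvelope
import HarnessLib

/-!
# Crux `HalfHolderEnergy.EnergyHalfHolder` (stmt-NavierStokesRegularity-25161), line «sparse_sieve» (line3):
# registered stub `stub_smoothingEnvelope` BY NAME

`--supports stmt-NavierStokesRegularity-25161`. The skeleton registered on the window-law crux `EnergyHalfHolder`
(planner ns-idea-9, `line3/sparse_sieve.lean`) has the SAME five typed pieces and the SAME registered signature for
`stub_smoothingEnvelope` as the skeleton `Cruxes/EnstrophyQuarterLaw/Lines/sparse_sieve.lean` of the shelf crux 1574 (signatures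
compared verbatim on the ledger, 2026-08-31). The stub was retired by name on 1574 as
`…Theorems.EnstrophyQuarterLaw.SparseSieve.Registered.stub_smoothingEnvelope` (content: the 2026-08-28 theorem with the predicates
unfolded); this file records the same theorem under the 25161 bookkeeping namespace so that the registry of
stmt-25161 can close its copy of the stub. Registry bookkeeping, no new mathematics:
for a maximal classical solution `u` on `[0,T)`, Leray–Hopf from its rapidly decaying datum, `SmoothingEnvelope T u` (quantitative rescaled localized smoothing; content p614511).
HONEST FRAMING: `EnergyHalfHolder` (25161), its open stubs S1/S2, the shelf crux `EnstrophyQuarterLaw` (1574) and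
Navier–Stokes regularity stay OPEN; no summit statement is proved.
-/

noncomputable section

-- the summit and its single sub-problem share the name (CONVENTIONS §1), as in every Theorems file
set_option linter.dupNamespace false

namespace Summit.NavierStokesRegularity.NavierStokesRegularity.Theorems.EnergyHalfHolder.SparseSieve.Registered

open MeasureTheory Set Metric
open Literature.Analysis.FluidPDE
open Summit.NavierStokesRegularity.NavierStokesRegularity.Theorems.EnstrophyQuarterLaw.SparseSieve
open scoped ENNReal

/-- Registered stub `stub_smoothingEnvelope` of line «sparse_sieve» on the crux `EnergyHalfHolder` (stmt-NavierStokesRegularity-25161),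
signature VERBATIM (predicates of `…EnstrophyQuarterLawSparseSieveDefs`):
for a maximal classical solution `u` on `[0,T)`, Leray–Hopf from its rapidly decaying datum, `SmoothingEnvelope T u` (quantitative rescaled localized smoothing; content p614511).
Proof: the by-name theorem of the identical stub on the shelf crux 1574,
`…Theorems.EnstrophyQuarterLaw.SparseSieve.Registered.stub_smoothingEnvelope`. [folklore] -/
theorem stub_smoothingEnvelope : ∀ (ν T : ℝ), 0 < ν → 0 < T → ∀ (u : ℝ → EuclideanSpace ℝ (Fin 3) → EuclideanSpace ℝ (Fin 3)) (p : ℝ → EuclideanSpace ℝ (Fin 3) → ℝ), IsMaximalSmoothSolution ν 0 u p T → IsLerayHopfOn T ν 0 (u 0) u → HasRapidSpatialDecay (u 0) →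
    SmoothingEnvelope T u :=
  _root_.Summit.NavierStokesRegularity.NavierStokesRegularity.Theorems.EnstrophyQuarterLaw.SparseSieve.Registered.stub_smoothingEnvelope

end Summit.NavierStokesRegularity.NavierStokesRegularity.Theorems.EnergyHalfHolder.SparseSieve.Registered

end
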